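import Summits.ValiantsHypothesis.ValiantsHypothesis.Theorems.RyserTripartitionPerLeTripartitionComponents
import Summits.ValiantsHypothesis.ValiantsHypothesis.Theorems.RyserTripartitionPerLeTripartitionTables
import HarnessLib

/-!
# ValiantsHypothesis / RyserTripartition — item `PerLeTripartition` (stmt-ValiantsHypothesis-11286):
# the set-multilinear homogenisation pass (three variable groups) with an input environment

Given a fan-in-two circuit `Γ` over variables `(i, s)`, `i : Fin 3` the GROUP, and a "growing"
plain fan-in-two syntactically multilinear gate list in which every substitute `φ (i, s)` is
available with syntactic support inside `Y i` (the three sets `Y 0, Y 1, Y 2` pairwise disjoint),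
the pass appends at most `152 · |Γ|` gates after which, for every gate value `g` of `Γ` and every
`J ⊆ Fin 3`, the polynomial `aeval φ (comp_J g)` — the substitute of the group-multilinear component
of multidegree `𝟙_J` — is available with syntactic support inside `⋃_{i ∈ J} Y i`, the list
staying plain, fan-in-two and SYNTACTICALLY MULTILINEAR (`pass_gates`): products
`comp_J(u w) = Σ_{J₁ ⊆ J} comp_{J₁} u · comp_{J∖J₁} w` multiply operands supported in the DISJOINT
sets `⋃_{J₁} Y`, `⋃_{J∖J₁} Y` (`groupComp_mul`, `Components` file); sums and scalars are
componentwise; variables and constants are read off the environment (`groupComp_X`, `groupComp_C`).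
The clone of `Homogenisation.hc_*` (`HomogeneousComponentsComplexity.lean`, BCS Lemma 21.25) in the
`SynAvail` plumbing.  HONEST FRAMING: bookkeeping toward a support item of a dormant route; nothing
here bears on `VP ≠ VNP`, which is NOT proved.
-/

-- layout Summits/ValiantsHypothesis/ValiantsHypothesis forces the duplicated namespace component
set_option linter.dupNamespace false

namespace Summit.ValiantsHypothesis.ValiantsHypothesis.Theorems.RyserTripartition

open Finset MvPolynomial Literature.Computability.AlgebraicComplexity
  Literature.Computability.AlgebraicComplexity.ArithCircuit
  Literature.Computability.AlgebraicComplexity.SynAvail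
open Literature.Barriers.ValiantsHypothesis (IsPlainGate)

namespace Pass

variable {R : Type*} [CommSemiring R] {S : Type*} {τ : Type*} [DecidableEq τ]
variable (φ : Fin 3 × S → MvPolynomial τ R) (Y : Fin 3 → Finset τ)

/-! ### Availability of a component (spelled out; no definitions)

`AV gs g J` below always means
`∃ u, u.RefsBelow gs.length ∧ u.eval (gateValues gs) = aeval φ (comp_J g) ∧
operandVarSet (gateVarSets gs) u ⊆ J.biUnion Y`. -/

/-- Availability of a component is monotone under extension. [folklore] -/
theorem av_mono {gs gs' : List (Gate R τ)} (h : gs <+: gs') {g : MvPolynomial (Fin 3 × S) R}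
    {J : Finset (Fin 3)}
    (hg : ∃ u : Operand R τ, u.RefsBelow gs.length ∧ u.eval (gateValues gs) =
        aeval φ (weightedHomogeneousComponent (fun v : Fin 3 × S => (Finsupp.single v.1 1 : Fin 3 →₀ ℕ))
          (∑ j ∈ J, Finsupp.single j 1) g) ∧
      operandVarSet (gateVarSets gs) u ⊆ J.biUnion Y) :
    ∃ u : Operand R τ, u.RefsBelow gs'.length ∧ u.eval (gateValues gs') =
        aeval φ (weightedHomogeneousComponent (fun v : Fin 3 × S => (Finsupp.single v.1 1 : Fin 3 →₀ ℕ))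
          (∑ j ∈ J, Finsupp.single j 1) g) ∧
      operandVarSet (gateVarSets gs') u ⊆ J.biUnion Y :=
  savail_mono h hg

/-- The zero polynomial: every component is available for free. [folklore] -/
theorem av_zero (gs : List (Gate R τ)) (J : Finset (Fin 3)) :
    ∃ u : Operand R τ, u.RefsBelow gs.length ∧ u.eval (gateValues gs) =
        aeval φ (weightedHomogeneousComponent (fun v : Fin 3 × S => (Finsupp.single v.1 1 : Fin 3 →₀ ℕ))
          (∑ j ∈ J, Finsupp.single j 1) (0 : MvPolynomial (Fin 3 × S) R)) ∧
      operandVarSet (gateVarSets gs) u ⊆ J.biUnion Y := by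
  rw [map_zero, map_zero, ← C_0]
  exact savail_C gs 0 _

/-- Constants: `comp_J (C c)` is `C c` or `0`, available for free. [folklore] -/
theorem av_C (gs : List (Gate R τ)) (J : Finset (Fin 3)) (c : R) :
    ∃ u : Operand R τ, u.RefsBelow gs.length ∧ u.eval (gateValues gs) =
        aeval φ (weightedHomogeneousComponent (fun v : Fin 3 × S => (Finsupp.single v.1 1 : Fin 3 →₀ ℕ))
          (∑ j ∈ J, Finsupp.single j 1) (C c : MvPolynomial (Fin 3 × S) R)) ∧
      operandVarSet (gateVarSets gs) u ⊆ J.biUnion Y := by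
  classical
  rw [groupComp_C]
  split_ifs
  · rw [MvPolynomial.aeval_C, MvPolynomial.algebraMap_eq]
    exact savail_C gs c _
  · rw [map_zero, ← C_0]
    exact savail_C gs 0 _

/-- Variables: `comp_J (X v)` is `X v` (then its substitute `φ v` is in the environment, support
`Y v.1 ⊆ ⋃_J Y`) or `0`. [folklore] -/
theorem av_X (gs : List (Gate R τ))
    (henv : ∀ v : Fin 3 × S, ∃ u : Operand R τ, u.RefsBelow gs.length ∧
      u.eval (gateValues gs) = φ v ∧ operandVarSet (gateVarSets gs) u ⊆ Y v.1)
    (J : Finset (Fin 3)) (v : Fin 3 × S) :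
    ∃ u : Operand R τ, u.RefsBelow gs.length ∧ u.eval (gateValues gs) =
        aeval φ (weightedHomogeneousComponent (fun v : Fin 3 × S => (Finsupp.single v.1 1 : Fin 3 →₀ ℕ))
          (∑ j ∈ J, Finsupp.single j 1) (X v : MvPolynomial (Fin 3 × S) R)) ∧
      operandVarSet (gateVarSets gs) u ⊆ J.biUnion Y := by
  classical
  rw [groupComp_X]
  split_ifs with h
  · rw [MvPolynomial.aeval_X]
    subst h
    refine savail_weaken ?_ (henv v)
    intro x hx; exact Finset.mem_biUnion.mpr ⟨v.1, Finset.mem_singleton_self _, hx⟩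
  · rw [map_zero, ← C_0]
    exact savail_C gs 0 _

/-- Operands of the old circuit (junk references read `0`). [folklore] -/
theorem av_operand (gs : List (Gate R τ))
    (henv : ∀ v : Fin 3 × S, ∃ u : Operand R τ, u.RefsBelow gs.length ∧
      u.eval (gateValues gs) = φ v ∧ operandVarSet (gateVarSets gs) u ⊆ Y v.1)
    (vals : List (MvPolynomial (Fin 3 × S) R))
    (hvals : ∀ g ∈ vals, ∀ J : Finset (Fin 3), ∃ u : Operand R τ, u.RefsBelow gs.length ∧
      u.eval (gateValues gs) =
        aeval φ (weightedHomogeneousComponent (fun v : Fin 3 × S => (Finsupp.single v.1 1 : Fin 3 →₀ ℕ))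
          (∑ j ∈ J, Finsupp.single j 1) g) ∧
      operandVarSet (gateVarSets gs) u ⊆ J.biUnion Y)
    (o : Operand R (Fin 3 × S)) (J : Finset (Fin 3)) :
    ∃ u : Operand R τ, u.RefsBelow gs.length ∧ u.eval (gateValues gs) =
        aeval φ (weightedHomogeneousComponent (fun v : Fin 3 × S => (Finsupp.single v.1 1 : Fin 3 →₀ ℕ))
          (∑ j ∈ J, Finsupp.single j 1) (o.eval vals)) ∧
      operandVarSet (gateVarSets gs) u ⊆ J.biUnion Y := by
  cases o with
  | var v => exact av_X φ Y gs henv J v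
  | const c => exact av_C φ Y gs J c
  | gate j =>
    simp only [Operand.eval, List.getD_eq_getElem?_getD]
    cases hj : vals[j]? with
    | none => exact av_zero φ Y gs J
    | some g => exact hvals g (List.mem_of_getElem? hj) J

/-- Disjoint sets of groups have disjoint support unions. [folklore] -/
theorem disjoint_biUnion_of_disjoint (hY : ∀ i j : Fin 3, i ≠ j → Disjoint (Y i) (Y j))
    {J₁ J₂ : Finset (Fin 3)} (h : Disjoint J₁ J₂) :
    Disjoint (J₁.biUnion Y) (J₂.biUnion Y) := by
  rw [Finset.disjoint_biUnion_left]
  intro i hi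
  rw [Finset.disjoint_biUnion_right]
  intro j hj
  exact hY i j (fun hij => Finset.disjoint_left.mp h hi (hij ▸ hj))

/-- **Products**: `aeval φ (comp_J (U · W)) = Σ_{J₁ ⊆ J} aeval φ (comp_{J₁} U) · aeval φ (comp_{J∖J₁} W)`,
each product joining DISJOINTLY supported operands; `16` gates. [folklore] -/
theorem av_mul (hY : ∀ i j : Fin 3, i ≠ j → Disjoint (Y i) (Y j))
    {gs : List (Gate R τ)} (hgs : ∀ g ∈ gs, g.fanIn ≤ 2 ∧ IsPlainGate g)
    (hml : ∀ (n : ℕ) (args : List (Operand R τ)), gs[n]? = some (.prod args) →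
      (args.map (operandVarSet (gateVarSets (gs.take n)))).Pairwise Disjoint)
    {U W : MvPolynomial (Fin 3 × S) R}
    (hU : ∀ J : Finset (Fin 3), ∃ u : Operand R τ, u.RefsBelow gs.length ∧ u.eval (gateValues gs) =
        aeval φ (weightedHomogeneousComponent (fun v : Fin 3 × S => (Finsupp.single v.1 1 : Fin 3 →₀ ℕ))
          (∑ j ∈ J, Finsupp.single j 1) U) ∧
      operandVarSet (gateVarSets gs) u ⊆ J.biUnion Y)
    (hW : ∀ J : Finset (Fin 3), ∃ u : Operand R τ, u.RefsBelow gs.length ∧ u.eval (gateValues gs) =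
        aeval φ (weightedHomogeneousComponent (fun v : Fin 3 × S => (Finsupp.single v.1 1 : Fin 3 →₀ ℕ))
          (∑ j ∈ J, Finsupp.single j 1) W) ∧
      operandVarSet (gateVarSets gs) u ⊆ J.biUnion Y)
    (J : Finset (Fin 3)) :
    ∃ gs' : List (Gate R τ), gs <+: gs' ∧ (∀ g ∈ gs', g.fanIn ≤ 2 ∧ IsPlainGate g) ∧
      (∀ (n : ℕ) (args : List (Operand R τ)), gs'[n]? = some (.prod args) →
        (args.map (operandVarSet (gateVarSets (gs'.take n)))).Pairwise Disjoint) ∧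
      gs'.length ≤ gs.length + 16 ∧
      ∃ u : Operand R τ, u.RefsBelow gs'.length ∧ u.eval (gateValues gs') =
        aeval φ (weightedHomogeneousComponent (fun v : Fin 3 × S => (Finsupp.single v.1 1 : Fin 3 →₀ ℕ))
          (∑ j ∈ J, Finsupp.single j 1) (U * W)) ∧
      operandVarSet (gateVarSets gs') u ⊆ J.biUnion Y := by
  classical
  set t : Finset (Fin 3) → MvPolynomial τ R := fun J₁ =>
    aeval φ (weightedHomogeneousComponent (fun v : Fin 3 × S => (Finsupp.single v.1 1 : Fin 3 →₀ ℕ))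
        (∑ j ∈ J₁, Finsupp.single j 1) U) *
      aeval φ (weightedHomogeneousComponent (fun v : Fin 3 × S => (Finsupp.single v.1 1 : Fin 3 →₀ ℕ))
        (∑ j ∈ J \ J₁, Finsupp.single j 1) W) with ht
  obtain ⟨gs', hp', hg', hm', hl', u, hu, hue, huV⟩ :=
    savail_list_sum t (J.biUnion Y) 1 J.powerset.toList gs hgs hml (by
      intro J₁ hJ₁ gs₁ hp₁ hg₁ hm₁
      rw [Finset.mem_toList, Finset.mem_powerset] at hJ₁
      obtain ⟨gs₂, hp₂, hg₂, hm₂, hl₂, hx⟩ := sextend_mul hg₁ hm₁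
        (disjoint_biUnion_of_disjoint Y hY (Finset.disjoint_sdiff : Disjoint J₁ (J \ J₁)))
        (savail_mono hp₁ (hU J₁)) (savail_mono hp₁ (hW (J \ J₁)))
      refine ⟨gs₂, hp₂, hg₂, hm₂, hl₂, savail_weaken ?_ hx⟩
      intro x hx
      rw [Finset.mem_union] at hx
      rcases hx with hx | hx
      · exact Finset.biUnion_subset_biUnion_of_subset_left Y hJ₁ hx
      · exact Finset.biUnion_subset_biUnion_of_subset_left Y Finset.sdiff_subset hx)
  refine ⟨gs', hp', hg', hm', ?_, u, hu, ?_, huV⟩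
  · have : J.powerset.toList.length ≤ 8 := by
      rw [Finset.length_toList, Finset.card_powerset]
      calc 2 ^ J.card ≤ 2 ^ 3 := Nat.pow_le_pow_right (by norm_num)
            (by simpa using Finset.card_le_univ J)
        _ = 8 := by norm_num
    omega
  · rw [hue, Finset.sum_map_toList, groupComp_mul, map_sum]
    exact Finset.sum_congr rfl fun J₁ _ => by rw [map_mul]

/-- **Weighted sums** `a • U + b • W`: componentwise, `3` gates. [folklore] -/
theorem av_add_smul {gs : List (Gate R τ)} (hgs : ∀ g ∈ gs, g.fanIn ≤ 2 ∧ IsPlainGate g)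
    (hml : ∀ (n : ℕ) (args : List (Operand R τ)), gs[n]? = some (.prod args) →
      (args.map (operandVarSet (gateVarSets (gs.take n)))).Pairwise Disjoint)
    (a b : R) {U W : MvPolynomial (Fin 3 × S) R} (J : Finset (Fin 3))
    (hU : ∃ u : Operand R τ, u.RefsBelow gs.length ∧ u.eval (gateValues gs) =
        aeval φ (weightedHomogeneousComponent (fun v : Fin 3 × S => (Finsupp.single v.1 1 : Fin 3 →₀ ℕ))
          (∑ j ∈ J, Finsupp.single j 1) U) ∧
      operandVarSet (gateVarSets gs) u ⊆ J.biUnion Y)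
    (hW : ∃ u : Operand R τ, u.RefsBelow gs.length ∧ u.eval (gateValues gs) =
        aeval φ (weightedHomogeneousComponent (fun v : Fin 3 × S => (Finsupp.single v.1 1 : Fin 3 →₀ ℕ))
          (∑ j ∈ J, Finsupp.single j 1) W) ∧
      operandVarSet (gateVarSets gs) u ⊆ J.biUnion Y) :
    ∃ gs' : List (Gate R τ), gs <+: gs' ∧ (∀ g ∈ gs', g.fanIn ≤ 2 ∧ IsPlainGate g) ∧
      (∀ (n : ℕ) (args : List (Operand R τ)), gs'[n]? = some (.prod args) →
        (args.map (operandVarSet (gateVarSets (gs'.take n)))).Pairwise Disjoint) ∧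
      gs'.length ≤ gs.length + 3 ∧
      ∃ u : Operand R τ, u.RefsBelow gs'.length ∧ u.eval (gateValues gs') =
        aeval φ (weightedHomogeneousComponent (fun v : Fin 3 × S => (Finsupp.single v.1 1 : Fin 3 →₀ ℕ))
          (∑ j ∈ J, Finsupp.single j 1) (a • U + b • W)) ∧
      operandVarSet (gateVarSets gs') u ⊆ J.biUnion Y := by
  obtain ⟨gs₁, hp₁, hg₁, hm₁, hl₁, h₁⟩ := sextend_smul a hgs hml hU
  obtain ⟨gs₂, hp₂, hg₂, hm₂, hl₂, h₂⟩ := sextend_smul b hg₁ hm₁ (savail_mono hp₁ hW)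
  obtain ⟨gs₃, hp₃, hg₃, hm₃, hl₃, h₃⟩ := sextend_add hg₂ hm₂ (savail_mono hp₂ h₁) h₂
  refine ⟨gs₃, hp₁.trans (hp₂.trans hp₃), hg₃, hm₃, by omega, ?_⟩
  rw [map_add, map_smul, map_smul, map_add, map_smul, map_smul, smul_eq_C_mul, smul_eq_C_mul]
  simpa only [Finset.union_idempotent] using h₃

/-- A single scaled operand `a • U`: `1` gate. [folklore] -/
theorem av_smul {gs : List (Gate R τ)} (hgs : ∀ g ∈ gs, g.fanIn ≤ 2 ∧ IsPlainGate g)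
    (hml : ∀ (n : ℕ) (args : List (Operand R τ)), gs[n]? = some (.prod args) →
      (args.map (operandVarSet (gateVarSets (gs.take n)))).Pairwise Disjoint)
    (a : R) {U : MvPolynomial (Fin 3 × S) R} (J : Finset (Fin 3))
    (hU : ∃ u : Operand R τ, u.RefsBelow gs.length ∧ u.eval (gateValues gs) =
        aeval φ (weightedHomogeneousComponent (fun v : Fin 3 × S => (Finsupp.single v.1 1 : Fin 3 →₀ ℕ))
          (∑ j ∈ J, Finsupp.single j 1) U) ∧
      operandVarSet (gateVarSets gs) u ⊆ J.biUnion Y) :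
    ∃ gs' : List (Gate R τ), gs <+: gs' ∧ (∀ g ∈ gs', g.fanIn ≤ 2 ∧ IsPlainGate g) ∧
      (∀ (n : ℕ) (args : List (Operand R τ)), gs'[n]? = some (.prod args) →
        (args.map (operandVarSet (gateVarSets (gs'.take n)))).Pairwise Disjoint) ∧
      gs'.length ≤ gs.length + 1 ∧
      ∃ u : Operand R τ, u.RefsBelow gs'.length ∧ u.eval (gateValues gs') =
        aeval φ (weightedHomogeneousComponent (fun v : Fin 3 × S => (Finsupp.single v.1 1 : Fin 3 →₀ ℕ))
          (∑ j ∈ J, Finsupp.single j 1) (a • U)) ∧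
      operandVarSet (gateVarSets gs') u ⊆ J.biUnion Y := by
  obtain ⟨gs₁, hp₁, hg₁, hm₁, hl₁, h₁⟩ := sextend_smul a hgs hml hU
  refine ⟨gs₁, hp₁, hg₁, hm₁, hl₁, ?_⟩
  rw [map_smul, map_smul, smul_eq_C_mul]
  exact h₁

/-- **One old gate, one component `J`**: a weighted sum (fan-in `≤ 2`) or a product (fan-in `≤ 2`)
of `Γ`; at most `16` new gates. [folklore] -/
theorem av_gate (hY : ∀ i j : Fin 3, i ≠ j → Disjoint (Y i) (Y j))
    {gs : List (Gate R τ)} (hgs : ∀ g ∈ gs, g.fanIn ≤ 2 ∧ IsPlainGate g)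
    (hml : ∀ (n : ℕ) (args : List (Operand R τ)), gs[n]? = some (.prod args) →
      (args.map (operandVarSet (gateVarSets (gs.take n)))).Pairwise Disjoint)
    (henv : ∀ v : Fin 3 × S, ∃ u : Operand R τ, u.RefsBelow gs.length ∧
      u.eval (gateValues gs) = φ v ∧ operandVarSet (gateVarSets gs) u ⊆ Y v.1)
    (vals : List (MvPolynomial (Fin 3 × S) R))
    (hvals : ∀ g ∈ vals, ∀ J : Finset (Fin 3), ∃ u : Operand R τ, u.RefsBelow gs.length ∧
      u.eval (gateValues gs) =
        aeval φ (weightedHomogeneousComponent (fun v : Fin 3 × S => (Finsupp.single v.1 1 : Fin 3 →₀ ℕ))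
          (∑ j ∈ J, Finsupp.single j 1) g) ∧
      operandVarSet (gateVarSets gs) u ⊆ J.biUnion Y)
    (g : Gate R (Fin 3 × S)) (hg : g.fanIn ≤ 2) (J : Finset (Fin 3)) :
    ∃ gs' : List (Gate R τ), gs <+: gs' ∧ (∀ g ∈ gs', g.fanIn ≤ 2 ∧ IsPlainGate g) ∧
      (∀ (n : ℕ) (args : List (Operand R τ)), gs'[n]? = some (.prod args) →
        (args.map (operandVarSet (gateVarSets (gs'.take n)))).Pairwise Disjoint) ∧
      gs'.length ≤ gs.length + 16 ∧
      ∃ u : Operand R τ, u.RefsBelow gs'.length ∧ u.eval (gateValues gs') =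
        aeval φ (weightedHomogeneousComponent (fun v : Fin 3 × S => (Finsupp.single v.1 1 : Fin 3 →₀ ℕ))
          (∑ j ∈ J, Finsupp.single j 1) (g.eval vals)) ∧
      operandVarSet (gateVarSets gs') u ⊆ J.biUnion Y := by
  have h0 : gs.length ≤ gs.length + 16 := Nat.le_add_right _ _
  have hop := av_operand φ Y gs henv vals hvals
  cases g with
  | sum args =>
    match args, hg with
    | [], _ =>
      refine ⟨gs, List.prefix_rfl, hgs, hml, h0, ?_⟩
      rw [show (Gate.sum ([] : List (R × Operand R (Fin 3 × S)))).eval vals = 0 by simp [Gate.eval]]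
      exact av_zero φ Y gs J
    | [a], _ =>
      obtain ⟨gs₁, hp₁, hg₁, hm₁, hl₁, hr₁⟩ := av_smul φ Y hgs hml a.1 J (hop a.2 J)
      refine ⟨gs₁, hp₁, hg₁, hm₁, by omega, ?_⟩
      rw [show (Gate.sum [a]).eval vals = a.1 • a.2.eval vals by simp [Gate.eval]]
      exact hr₁
    | [a, b], _ =>
      obtain ⟨gs₁, hp₁, hg₁, hm₁, hl₁, hr₁⟩ :=
        av_add_smul φ Y hgs hml a.1 b.1 J (hop a.2 J) (hop b.2 J)
      refine ⟨gs₁, hp₁, hg₁, hm₁, by omega, ?_⟩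
      rw [show (Gate.sum [a, b]).eval vals = a.1 • a.2.eval vals + b.1 • b.2.eval vals by
        simp [Gate.eval]]
      exact hr₁
    | _ :: _ :: _ :: _, hg => simp [Gate.fanIn, Gate.args] at hg
  | prod args =>
    match args, hg with
    | [], _ =>
      refine ⟨gs, List.prefix_rfl, hgs, hml, h0, ?_⟩
      rw [show (Gate.prod ([] : List (Operand R (Fin 3 × S)))).eval vals = C 1 by simp [Gate.eval]]
      exact av_C φ Y gs J 1
    | [u], _ =>
      refine ⟨gs, List.prefix_rfl, hgs, hml, h0, ?_⟩
      rw [show (Gate.prod [u]).eval vals = u.eval vals by simp [Gate.eval]]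
      exact hop u J
    | [u, w], _ =>
      obtain ⟨gs₁, hp₁, hg₁, hm₁, hl₁, hr₁⟩ :=
        av_mul φ Y hY hgs hml (fun J' => hop u J') (fun J' => hop w J') J
      refine ⟨gs₁, hp₁, hg₁, hm₁, hl₁, ?_⟩
      rw [show (Gate.prod [u, w]).eval vals = u.eval vals * w.eval vals by simp [Gate.eval]]
      exact hr₁
    | _ :: _ :: _ :: _, hg => simp [Gate.fanIn, Gate.args] at hg

/-- **One old gate, all eight components**: at most `8 · 16 = 128` new gates. [folklore] -/
theorem av_gate_all (hY : ∀ i j : Fin 3, i ≠ j → Disjoint (Y i) (Y j))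
    {gs : List (Gate R τ)} (hgs : ∀ g ∈ gs, g.fanIn ≤ 2 ∧ IsPlainGate g)
    (hml : ∀ (n : ℕ) (args : List (Operand R τ)), gs[n]? = some (.prod args) →
      (args.map (operandVarSet (gateVarSets (gs.take n)))).Pairwise Disjoint)
    (henv : ∀ v : Fin 3 × S, ∃ u : Operand R τ, u.RefsBelow gs.length ∧
      u.eval (gateValues gs) = φ v ∧ operandVarSet (gateVarSets gs) u ⊆ Y v.1)
    (vals : List (MvPolynomial (Fin 3 × S) R))
    (hvals : ∀ g ∈ vals, ∀ J : Finset (Fin 3), ∃ u : Operand R τ, u.RefsBelow gs.length ∧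
      u.eval (gateValues gs) =
        aeval φ (weightedHomogeneousComponent (fun v : Fin 3 × S => (Finsupp.single v.1 1 : Fin 3 →₀ ℕ))
          (∑ j ∈ J, Finsupp.single j 1) g) ∧
      operandVarSet (gateVarSets gs) u ⊆ J.biUnion Y)
    (g : Gate R (Fin 3 × S)) (hg : g.fanIn ≤ 2) :
    ∃ gs' : List (Gate R τ), gs <+: gs' ∧ (∀ g ∈ gs', g.fanIn ≤ 2 ∧ IsPlainGate g) ∧
      (∀ (n : ℕ) (args : List (Operand R τ)), gs'[n]? = some (.prod args) →
        (args.map (operandVarSet (gateVarSets (gs'.take n)))).Pairwise Disjoint) ∧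
      gs'.length ≤ gs.length + 128 ∧
      ∀ J : Finset (Fin 3), ∃ u : Operand R τ, u.RefsBelow gs'.length ∧ u.eval (gateValues gs') =
        aeval φ (weightedHomogeneousComponent (fun v : Fin 3 × S => (Finsupp.single v.1 1 : Fin 3 →₀ ℕ))
          (∑ j ∈ J, Finsupp.single j 1) (g.eval vals)) ∧
      operandVarSet (gateVarSets gs') u ⊆ J.biUnion Y := by
  classical
  set L := (Finset.univ : Finset (Finset (Fin 3))).toList with hLdef
  have hL : L.length = 8 := by
    rw [hLdef, Finset.length_toList, Finset.card_univ, Fintype.card_finset, Fintype.card_fin]; rfl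
  obtain ⟨gs', hp', hg', hm', hl', hQ⟩ := siterate_extend
    (Q := fun l gs' => ∃ u : Operand R τ, u.RefsBelow gs'.length ∧ u.eval (gateValues gs') =
        aeval φ (weightedHomogeneousComponent (fun v : Fin 3 × S => (Finsupp.single v.1 1 : Fin 3 →₀ ℕ))
          (∑ j ∈ L.getD l ∅, Finsupp.single j 1) (g.eval vals)) ∧
      operandVarSet (gateVarSets gs') u ⊆ (L.getD l ∅).biUnion Y)
    (fun l gs₁ gs₂ h hq => savail_mono h hq) 16 gs hgs hml L.length (by
      intro l _ gs₁ hp₁ hg₁ hm₁ _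
      exact av_gate φ Y hY hg₁ hm₁ (fun v => savail_mono hp₁ (henv v)) vals
        (fun g' hg' J' => savail_mono hp₁ (hvals g' hg' J')) g hg (L.getD l ∅))
  refine ⟨gs', hp', hg', hm', by rw [hL] at hl'; omega, fun J => ?_⟩
  have hmem : J ∈ L := by rw [hLdef, Finset.mem_toList]; exact Finset.mem_univ _
  obtain ⟨l, hl, hlJ⟩ := List.getElem_of_mem hmem
  have hget : L.getD l ∅ = J := by
    rw [List.getD_eq_getElem?_getD, List.getElem?_eq_getElem hl, Option.getD_some, hlJ]
  have := hQ l hl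
  rw [hget] at this
  exact this

/-- **The pass over the whole gate list** `cs` of `Γ`: at most `128 · |cs|` new gates after which
every component of every gate value is available (with its support bound), the list plain,
fan-in-two and syntactically multilinear. [folklore] -/
theorem pass_gates (hY : ∀ i j : Fin 3, i ≠ j → Disjoint (Y i) (Y j))
    (gs₀ : List (Gate R τ)) (hgs₀ : ∀ g ∈ gs₀, g.fanIn ≤ 2 ∧ IsPlainGate g)
    (hml₀ : ∀ (n : ℕ) (args : List (Operand R τ)), gs₀[n]? = some (.prod args) →
      (args.map (operandVarSet (gateVarSets (gs₀.take n)))).Pairwise Disjoint)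
    (henv : ∀ v : Fin 3 × S, ∃ u : Operand R τ, u.RefsBelow gs₀.length ∧
      u.eval (gateValues gs₀) = φ v ∧ operandVarSet (gateVarSets gs₀) u ⊆ Y v.1)
    (cs : List (Gate R (Fin 3 × S))) (hcs : ∀ g ∈ cs, g.fanIn ≤ 2) :
    ∃ gs : List (Gate R τ), gs₀ <+: gs ∧ (∀ g ∈ gs, g.fanIn ≤ 2 ∧ IsPlainGate g) ∧
      (∀ (n : ℕ) (args : List (Operand R τ)), gs[n]? = some (.prod args) →
        (args.map (operandVarSet (gateVarSets (gs.take n)))).Pairwise Disjoint) ∧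
      gs.length ≤ gs₀.length + 128 * cs.length ∧
      ∀ g ∈ gateValues cs, ∀ J : Finset (Fin 3), ∃ u : Operand R τ, u.RefsBelow gs.length ∧
        u.eval (gateValues gs) =
          aeval φ (weightedHomogeneousComponent (fun v : Fin 3 × S => (Finsupp.single v.1 1 : Fin 3 →₀ ℕ))
            (∑ j ∈ J, Finsupp.single j 1) g) ∧
        operandVarSet (gateVarSets gs) u ⊆ J.biUnion Y := by
  induction cs using List.reverseRecOn with
  | nil =>
    exact ⟨gs₀, List.prefix_rfl, hgs₀, hml₀, by simp, fun g hg => by simp [gateValues] at hg⟩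
  | append_singleton cs g ih =>
    obtain ⟨gs₁, hp₁, hg₁, hm₁, hl₁, hr₁⟩ := ih (fun g' hg' => hcs g' (by simp [hg']))
    obtain ⟨gs₂, hp₂, hg₂, hm₂, hl₂, hr₂⟩ := av_gate_all φ Y hY hg₁ hm₁
      (fun v => savail_mono hp₁ (henv v)) (gateValues cs) hr₁ g (hcs g (by simp))
    refine ⟨gs₂, hp₁.trans hp₂, hg₂, hm₂, ?_, ?_⟩
    · simp only [List.length_append, List.length_singleton]; omega
    · intro v hv J
      rw [gateValues_append_singleton, List.mem_append, List.mem_singleton] at hv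
      rcases hv with hv | rfl
      · exact savail_mono hp₂ (hr₁ v hv J)
      · exact hr₂ J

end Pass

end Summit.ValiantsHypothesis.ValiantsHypothesis.Theorems.RyserTripartition
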